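import Mathlib

/-!
# Good facets — reduction to the four-common-neighbours and minimum-degree-four facts
(crux `SquareWellLayerCake.GapTwelveToBarlow`, line `Sketch`, stub `stub_goodFacets`)

`stub_goodFacets` (for a four-deep Good site `i`, any three distinct link sites on a supporting
plane `⟪n, · − x i⟫ = 1` of the link polytope span at least two bonds) is reduced to two finite
statements in the crux's own vocabulary, found numerically to be the mechanism by which the
one-deep zoo of exotic links dies two shells deep (wave 5, `work/stubs/goodFacets-REPORT-w5.md`):

* **FourCommon** (multi-shell, the content; hypothesis `hfour` below, stated under the stub's own
  four-deep hypothesis): every bonded pair `(i, a)` at a four-deep Good site has AT LEAST four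
  common neighbours within distance `1` (the landed sign lemma `stub_noSixCommonNeighbours` gives
  at most five: so every bond is the axis of a four-ring or of a five-ring, as in the Barlow and
  BPP links).  Numerically (two twelve-shells around a bonded pair, all pair distances in
  `[55/57, 1] ∪ [11/10, ∞)`): `≤ 2` shared sites is infeasible with separation slack `2–9 %`;
  exactly `3` shared sites is feasible for the bare pair of shells but only with link vertices of
  degree `2`, which the same fact excludes one shell further out.
* **MinDegFourFacets** (one-deep; hypothesis `hdeg4`): a Good site whose link pairs obey the
  `11/10`-dichotomy and whose every link site has at least four bonded link neighbours has good
  facets (numerically: no supporting plane with a `≤ 1`-bond tight triple exists; the one-deep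
  zoo's `≥ 5`-gonal faces all have a vertex of link degree `≤ 3`).

Contents: `eleven_tenths_lt_dist_of_good` (a Good site has no other site at distance in
`(1, 11/10]`), `linkDichotomy_of_deepGood` (hence the link pairs of a two-deep site obey the
dichotomy), and the registered anchor `goodFacets_of_fourCommon_of_minDegFacets`
(FourCommon → MinDegFourFacets → `stub_goodFacets` verbatim).
-/

noncomputable section

namespace Summit.AtomisticToContinuum.Crystallization.Theorems.SquareWellLayerCakeGapTwelveToBarlow

open Finset

/-- **The empty shell of a Good site.** If exactly twelve other sites lie within distance `1` of
`x l` and at most twelve within `11/10`, then every other site at distance `> 1` from `x l` is at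
distance `> 11/10`. -/
theorem eleven_tenths_lt_dist_of_good {N : ℕ} {x : Fin N → EuclideanSpace ℝ (Fin 3)} {l : Fin N}
    (h1 : (Finset.univ.filter fun j' : Fin N => j' ≠ l ∧ dist (x l) (x j') ≤ 1).card = 12)
    (h11 : (Finset.univ.filter fun j' : Fin N => j' ≠ l ∧ dist (x l) (x j') ≤ 11 / 10).card ≤ 12)
    {j : Fin N} (hj : j ≠ l) (hgt : 1 < dist (x l) (x j)) : 11 / 10 < dist (x l) (x j) := by
  classical
  set S1 := Finset.univ.filter fun j' : Fin N => j' ≠ l ∧ dist (x l) (x j') ≤ 1 with hS1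
  set S11 := Finset.univ.filter fun j' : Fin N => j' ≠ l ∧ dist (x l) (x j') ≤ 11 / 10 with hS11
  have hsub : S1 ⊆ S11 := by
    intro j' hj'
    simp only [hS1, hS11, Finset.mem_filter, Finset.mem_univ, true_and] at hj' ⊢
    exact ⟨hj'.1, hj'.2.trans (by norm_num)⟩
  have heq : S1 = S11 := Finset.eq_of_subset_of_card_le hsub (by rw [h1]; exact h11)
  by_contra hle
  push Not at hle
  have hmem : j ∈ S11 := by
    simp only [hS11, Finset.mem_filter, Finset.mem_univ, true_and]
    exact ⟨hj, hle⟩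
  rw [← heq] at hmem
  simp only [hS1, Finset.mem_filter, Finset.mem_univ, true_and] at hmem
  linarith [hmem.2]

/-- **Link dichotomy two shells deep.** If every site within distance `2` of `x i` is Good, then
two link sites of `i` are either bonded (distance `≤ 1`) or more than `11/10` apart. -/
theorem linkDichotomy_of_deepGood {N : ℕ} {x : Fin N → EuclideanSpace ℝ (Fin 3)} {i : Fin N}
    (h : ∀ l : Fin N, dist (x i) (x l) ≤ 2 →
      ((∀ j' : Fin N, dist (x l) (x j') ≤ 11 / 10 → ∀ k : Fin N, k ≠ j' →
          (55 : ℝ) / 57 ≤ dist (x j') (x k)) ∧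
        (Finset.univ.filter fun j' : Fin N => j' ≠ l ∧ dist (x l) (x j') ≤ 1).card = 12 ∧
        (Finset.univ.filter fun j' : Fin N => j' ≠ l ∧ dist (x l) (x j') ≤ 11 / 10).card ≤ 12))
    {l l' : Fin N} (hl : dist (x i) (x l) ≤ 1) (hgt : 1 < dist (x l) (x l')) :
    11 / 10 < dist (x l) (x l') := by
  have hG := h l (hl.trans (by norm_num))
  have hne : l' ≠ l := by
    rintro rfl
    rw [dist_self] at hgt
    linarith
  exact eleven_tenths_lt_dist_of_good hG.2.1 hG.2.2 hne hgt

/-- **Reduction of `stub_goodFacets` to FourCommon and MinDegFourFacets** (registered anchor).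
`hfour` = FourCommon: at a four-deep Good site, a bonded pair has at least four common neighbours
within distance `1`.  `hdeg4` = MinDegFourFacets: a Good site with the `11/10` link dichotomy and every
link site of link degree `≥ 4` has good facets.  Conclusion: the registered signature of
`stub_goodFacets` verbatim. -/
theorem goodFacets_of_fourCommon_of_minDegFacets :
    (∀ (N : ℕ) (x : Fin N → EuclideanSpace ℝ (Fin 3)) (i a : Fin N),
      (∀ l : Fin N, dist (x i) (x l) ≤ 4 →
        ((∀ j' : Fin N, dist (x l) (x j') ≤ 11 / 10 → ∀ k : Fin N, k ≠ j' →
            (55 : ℝ) / 57 ≤ dist (x j') (x k)) ∧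
          (Finset.univ.filter fun j' : Fin N => j' ≠ l ∧ dist (x l) (x j') ≤ 1).card = 12 ∧
          (Finset.univ.filter fun j' : Fin N => j' ≠ l ∧ dist (x l) (x j') ≤ 11 / 10).card ≤ 12)) →
      a ≠ i → dist (x i) (x a) ≤ 1 →
      4 ≤ (Finset.univ.filter fun k : Fin N =>
        k ≠ i ∧ k ≠ a ∧ dist (x i) (x k) ≤ 1 ∧ dist (x a) (x k) ≤ 1).card) →
    (∀ (N : ℕ) (x : Fin N → EuclideanSpace ℝ (Fin 3)) (i : Fin N),
      ((∀ j' : Fin N, dist (x i) (x j') ≤ 11 / 10 → ∀ k : Fin N, k ≠ j' →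
          (55 : ℝ) / 57 ≤ dist (x j') (x k)) ∧
        (Finset.univ.filter fun j' : Fin N => j' ≠ i ∧ dist (x i) (x j') ≤ 1).card = 12 ∧
        (Finset.univ.filter fun j' : Fin N => j' ≠ i ∧ dist (x i) (x j') ≤ 11 / 10).card ≤ 12) →
      (∀ l l' : Fin N, l ≠ i → l' ≠ i → dist (x i) (x l) ≤ 1 → dist (x i) (x l') ≤ 1 →
        1 < dist (x l) (x l') → (11 : ℝ) / 10 ≤ dist (x l) (x l')) →
      (∀ a : Fin N, a ≠ i → dist (x i) (x a) ≤ 1 →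
        4 ≤ (Finset.univ.filter fun k : Fin N =>
          k ≠ i ∧ k ≠ a ∧ dist (x i) (x k) ≤ 1 ∧ dist (x a) (x k) ≤ 1).card) →
      ∀ (n : EuclideanSpace ℝ (Fin 3)) (a b c : Fin N),
        (∀ l : Fin N, l ≠ i → dist (x i) (x l) ≤ 1 → inner ℝ n (x l - x i) ≤ 1) →
        a ≠ i → b ≠ i → c ≠ i → a ≠ b → b ≠ c → a ≠ c →
        dist (x i) (x a) ≤ 1 → dist (x i) (x b) ≤ 1 → dist (x i) (x c) ≤ 1 →
        inner ℝ n (x a - x i) = 1 → inner ℝ n (x b - x i) = 1 → inner ℝ n (x c - x i) = 1 →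
        (dist (x a) (x b) ≤ 1 ∧ dist (x b) (x c) ≤ 1) ∨ (dist (x b) (x c) ≤ 1 ∧ dist (x c) (x a) ≤ 1) ∨
          (dist (x c) (x a) ≤ 1 ∧ dist (x a) (x b) ≤ 1)) →
    ∀ (N : ℕ) (x : Fin N → EuclideanSpace ℝ (Fin 3)) (i : Fin N), (∀ l : Fin N, dist (x i) (x l) ≤
    4 → ((∀ j' : Fin N, dist (x l) (x j') ≤ 11 / 10 → ∀ k : Fin N, k ≠ j' → (55 : ℝ) / 57 ≤ dist (x
    j') (x k)) ∧ (Finset.univ.filter fun j' : Fin N => j' ≠ l ∧ dist (x l) (x j') ≤ 1).card = 12 ∧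
    (Finset.univ.filter fun j' : Fin N => j' ≠ l ∧ dist (x l) (x j') ≤ 11 / 10).card ≤ 12)) → ∀ (n
    : EuclideanSpace ℝ (Fin 3)) (a b c : Fin N), (∀ l : Fin N, l ≠ i → dist (x i) (x l) ≤ 1 → inner
    ℝ n (x l - x i) ≤ 1) → a ≠ i → b ≠ i → c ≠ i → a ≠ b → b ≠ c → a ≠ c → dist (x i) (x a) ≤ 1 →
    dist (x i) (x b) ≤ 1 → dist (x i) (x c) ≤ 1 → inner ℝ n (x a - x i) = 1 → inner ℝ n (x b - x i)
    = 1 → inner ℝ n (x c - x i) = 1 → (dist (x a) (x b) ≤ 1 ∧ dist (x b) (x c) ≤ 1) ∨ (dist (x b)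
    (x c) ≤ 1 ∧ dist (x c) (x a) ≤ 1) ∨ (dist (x c) (x a) ≤ 1 ∧ dist (x a) (x b) ≤ 1) := by
  intro hfour hdeg4 N x i h4
  have h2 : ∀ l : Fin N, dist (x i) (x l) ≤ 2 →
      ((∀ j' : Fin N, dist (x l) (x j') ≤ 11 / 10 → ∀ k : Fin N, k ≠ j' →
          (55 : ℝ) / 57 ≤ dist (x j') (x k)) ∧
        (Finset.univ.filter fun j' : Fin N => j' ≠ l ∧ dist (x l) (x j') ≤ 1).card = 12 ∧
        (Finset.univ.filter fun j' : Fin N => j' ≠ l ∧ dist (x l) (x j') ≤ 11 / 10).card ≤ 12) :=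
    fun l hl => h4 l (hl.trans (by norm_num))
  have hGi := h2 i (by rw [dist_self]; norm_num)
  refine hdeg4 N x i hGi ?_ ?_
  · intro l l' _ _ hil _ hgt
    exact (linkDichotomy_of_deepGood h2 hil hgt).le
  · intro a hai hia
    exact hfour N x i a h4 hai hia

end Summit.AtomisticToContinuum.Crystallization.Theorems.SquareWellLayerCakeGapTwelveToBarlow

end
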